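import Literature.NumberTheory.LFunctions.MertensZeroCertificate
import Literature.NumberTheory.LFunctions.MertensConjectureDisproofNumerics
import Literature.NumberTheory.DiophantineGeometry.NamedHypothesesProofs
import HarnessLib

/-!
# Disproof of the Mertens conjecture: zero bracketings and the rh.S22 statements from interval bounds

Topic `Literature/NumberTheory/LFunctions` (summit `RiemannHypothesis`, inventory id rh.S22).
A thin packaging layer over the certificate lemmas of `MertensZeroCertificate.lean` (the analytic
glue of the certified Odlyzko–te Riele computation: twisted sign test
`exists_zero_Icc_of_re_mul_conj_neg`, exact count `zetaZeroCount_eq_of_hpieces`, zero clause and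
completeness `zeros_below_of_count_eq_card`, and `re_inghamSum_eq_sum_of_zeros`) and over the
assembly files `MertensConjectureDisproof*.lean`, providing:

* a **bundled form of the zero data**, `ZeroBracketing n T a b`: `n` pairwise separated closed
  brackets `0 < a₀ ≤ b₀ < a₁ ≤ ⋯ ≤ b_{n−1} < T`, each containing an ordinate of a zero of `ζ` on the
  critical line. This is the shape in which a high-precision computation isolates zeros
  (Odlyzko–te Riele: `n = 2000`, `b_j − a_j ≈ 10⁻⁷⁵`). It is *not* a special case of the chain of
  sample points `t₀ < t₁ < ⋯ < t_k` with a sign change of `Z` on every `[t_i, t_{i+1}]` of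
  `Literature.NumberTheory.LFunctions.le_criticalZeroCount_of_sign_changes` (`TuringMethod.lean`): of the `2n − 1` consecutive
  intervals only every other one carries a certificate. Relative to the `Finset`-of-ordinates form
  of `MertensZeroCertificate.lean` it adds the bracket bookkeeping (choice of the ordinate in each
  bracket, distinctness from separation, `n ≤ N₀(T) ≤ N(T)`, hence RH up to `T` and `N(T) = n`
  from an upper bound `N(T) ≤ n`) and quantifies the final bounds over the brackets;
* **constructors**: from a sign change of Hardy's `Z` at the bracket ends (`of_hardyZ_sign`; needs
  `θ` at each end, cf. `HardyZSignCertificate.lean`), and from the twisted sign test of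
  `MertensZeroCertificate.lean` (`of_re_mul_conj_neg`; no `θ` at all, only `|θ'| ≤ 10`);
* the **rh.S22 statements from interval bounds**: with `N(T) ≤ n`, the located ordinates are all
  the zeros below `T`, on the line and simple, `Re h_K(y) = Σ_j 2 Re F_y(γ_j)` with
  `F_y(γ) = k(γ)e^{iγy}/((½+iγ)ζ'(½+iγ))` (`inghamTerm`), and bounds for these explicit sums valid
  for *all* `γ_j ∈ [a_j, b_j]` — all a validated computation can know — give
  `OdlyzkoTeRiele1985_numerics` / `_table3` and the three rh.S22 statements
  (`numerics_of_bounds`, `table3_of_bounds`, `limsup_of_bounds`, `liminf_of_bounds`,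
  `not_mertens_conjecture_of_bounds`; the last from any height `T > 0` and any bound `> 1`). In
  particular the dependency of `MertensConjectureDisproofNumerics.lean` on
  `Brent1979_zerosSimpleOnLine` disappears: the zero clause is a *consequence* of the certificate.

## References

* [OdlyzkoTeRiele1985] A. M. Odlyzko, H. J. J. te Riele, *Disproof of the Mertens conjecture*,
  J. reine angew. Math. 357 (1985) 138–160: Theorem p. 144, §4.2–4.3 pp. 151–155.
* [Brent1979] R. P. Brent, Math. Comp. 33 (1979) 1361–1372, §3–4 (zeros on the line from sign
  changes; all zeros accounted for once the count matches).
* [EdwardsZeta1974] H. M. Edwards, *Riemann's Zeta Function*, 1974, §8.2–8.3.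
-/

noncomputable section

open Complex Filter Set MeasureTheory
open scoped Real Topology ComplexConjugate

namespace Literature.NumberTheory.LFunctions

open DiophantineGeometry

/-! ## Zero bracketings -/

/-- A **zero bracketing** of height `T` with `n` brackets: pairwise separated closed intervals
`0 < a_j ≤ b_j`, `b_j < a_k` (`j < k`), `b_j < T`, each containing the ordinate of a zero of `ζ` on
the critical line. [cite: Brent1979, §3] -/
structure ZeroBracketing (n : ℕ) (T : ℝ) (a b : Fin n → ℝ) : Prop where
  le : ∀ j, a j ≤ b j
  sep : ∀ j k, j < k → b j < a k
  pos : ∀ j, 0 < a j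
  ltT : ∀ j, b j < T
  hasZero : ∀ j, ∃ γ : ℝ, a j ≤ γ ∧ γ ≤ b j ∧ riemannZeta (1 / 2 + γ * I) = 0

namespace ZeroBracketing

variable {n : ℕ} {T : ℝ} {a b : Fin n → ℝ}

/-- **Constructor: sign changes of `Z`.** If `Z(a_j) Z(b_j) < 0` on separated brackets below `T`,
the brackets form a zero bracketing (intermediate value theorem for the continuous real function
`Z`, and `Z(t) = 0 ↔ ζ(½+it) = 0`, `Literature.NumberTheory.LFunctions.hardyZ_eq_zero_iff_holds`). For certifying the sign of `Z`
from `ζ(½+it)` and a rough `θ(t)` see `HardyZSignCertificate.lean`. [cite: EdwardsZeta1974, §8.3] -/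
theorem of_hardyZ_sign (hle : ∀ j, a j ≤ b j) (hsep : ∀ j k, j < k → b j < a k)
    (hpos : ∀ j, 0 < a j) (hltT : ∀ j, b j < T)
    (hsign : ∀ j, hardyZ (a j) * hardyZ (b j) < 0) : ZeroBracketing n T a b where
  le := hle
  sep := hsep
  pos := hpos
  ltT := hltT
  hasZero j := by
    have hc : ContinuousOn hardyZ (Icc (a j) (b j)) := continuous_hardyZ.continuousOn
    have hs := hsign j
    have hab : a j < b j := by
      rcases (hle j).eq_or_lt with h | h
      · rw [h] at hs; nlinarith
      · exact h
    rcases lt_or_gt_of_ne (show hardyZ (a j) ≠ 0 from fun h0 ↦ by simp [h0] at hs) with ha | ha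
    · have hb : 0 < hardyZ (b j) := by
        by_contra hb; push Not at hb
        have := mul_nonneg_of_nonpos_of_nonpos ha.le hb
        linarith
      obtain ⟨γ, hγ, hγ0⟩ := intermediate_value_Ioo hab.le hc ⟨ha, hb⟩
      exact ⟨γ, hγ.1.le, hγ.2.le, (hardyZ_eq_zero_iff_holds γ).1 hγ0⟩
    · have hb : hardyZ (b j) < 0 := by
        by_contra hb; push Not at hb
        have := mul_nonneg ha.le hb
        linarith
      obtain ⟨γ, hγ, hγ0⟩ := intermediate_value_Ioo' hab.le hc ⟨hb, ha⟩
      exact ⟨γ, hγ.1.le, hγ.2.le, (hardyZ_eq_zero_iff_holds γ).1 hγ0⟩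

/-- **Constructor: the twisted sign test** of `MertensZeroCertificate.lean`
(`exists_zero_Icc_of_re_mul_conj_neg'`): for brackets with `1 ≤ a_j`, `b_j ≤ 2²⁰`,
`b_j − a_j ≤ 1/8`, the condition `Re (ζ(½+ia_j) · conj ζ(½+ib_j)) < 0` — two validated values of `ζ`
on the line, no `θ` — places a zero in each bracket. [cite: Brent1979, §3] -/
theorem of_re_mul_conj_neg (hle : ∀ j, a j ≤ b j) (hsep : ∀ j k, j < k → b j < a k)
    (hone : ∀ j, 1 ≤ a j) (htop : ∀ j, b j ≤ 2 ^ 20) (hgap : ∀ j, b j - a j ≤ 1 / 8)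
    (hltT : ∀ j, b j < T)
    (hneg : ∀ j, (riemannZeta (1 / 2 + a j * I) * conj (riemannZeta (1 / 2 + b j * I))).re < 0) :
    ZeroBracketing n T a b where
  le := hle
  sep := hsep
  pos j := by linarith [hone j]
  ltT := hltT
  hasZero j := by
    obtain ⟨γ, hγ, h0⟩ := exists_zero_Icc_of_re_mul_conj_neg' (hone j) (hle j) (htop j) (hgap j)
      (hneg j)
    exact ⟨γ, hγ.1, hγ.2, h0⟩

/-- The ordinate `γ_j ∈ [a_j, b_j]` of a zero in the `j`-th bracket (a choice; under `N(T) ≤ n`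
it is the unique one, `mem_brackets_of_zero`). [folklore] -/
def ordinate (h : ZeroBracketing n T a b) (j : Fin n) : ℝ :=
  Classical.choose (h.hasZero j)

/-- `a_j ≤ γ_j`. [folklore] -/
theorem le_ordinate (h : ZeroBracketing n T a b) (j : Fin n) : a j ≤ h.ordinate j :=
  (Classical.choose_spec (h.hasZero j)).1

/-- `γ_j ≤ b_j`. [folklore] -/
theorem ordinate_le (h : ZeroBracketing n T a b) (j : Fin n) : h.ordinate j ≤ b j :=
  (Classical.choose_spec (h.hasZero j)).2.1

/-- `ζ(½ + iγ_j) = 0`. [folklore] -/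
theorem zeta_ordinate (h : ZeroBracketing n T a b) (j : Fin n) :
    riemannZeta (1 / 2 + h.ordinate j * I) = 0 :=
  (Classical.choose_spec (h.hasZero j)).2.2

/-- `0 < γ_j`. [folklore] -/
theorem ordinate_pos (h : ZeroBracketing n T a b) (j : Fin n) : 0 < h.ordinate j :=
  (h.pos j).trans_le (h.le_ordinate j)

/-- `γ_j < T`. [folklore] -/
theorem ordinate_lt_height (h : ZeroBracketing n T a b) (j : Fin n) : h.ordinate j < T :=
  (h.ordinate_le j).trans_lt (h.ltT j)

/-- A non-empty bracketing has positive height. [folklore] -/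
theorem height_pos [NeZero n] (h : ZeroBracketing n T a b) : 0 < T :=
  (h.ordinate_pos 0).trans (h.ordinate_lt_height 0)

/-- The ordinates are strictly increasing (the brackets are separated). [folklore] -/
theorem ordinate_strictMono (h : ZeroBracketing n T a b) : StrictMono h.ordinate :=
  fun j k hjk ↦ (h.ordinate_le j).trans_lt ((h.sep j k hjk).trans_le (h.le_ordinate k))

/-- The ordinates are distinct. [folklore] -/
theorem ordinate_injective (h : ZeroBracketing n T a b) : Function.Injective h.ordinate :=
  h.ordinate_strictMono.injective

/-- The finite set `Z = {γ_0, …, γ_{n−1}}` of located ordinates (the datum of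
`MertensZeroCertificate.lean`). [folklore] -/
def ordinates (h : ZeroBracketing n T a b) : Finset ℝ := Finset.univ.image h.ordinate

/-- `Z` has `n` elements. [folklore] -/
theorem card_ordinates (h : ZeroBracketing n T a b) : h.ordinates.card = n := by
  classical
  rw [ordinates, Finset.card_image_of_injective _ h.ordinate_injective, Finset.card_univ,
    Fintype.card_fin]

/-- Every located ordinate is that of a zero on the line with `0 < γ < T`. [folklore] -/
theorem ordinates_spec (h : ZeroBracketing n T a b) :
    ∀ γ ∈ h.ordinates, riemannZeta (1 / 2 + γ * I) = 0 ∧ 0 < γ ∧ γ < T := by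
  classical
  intro γ hγ
  obtain ⟨j, -, rfl⟩ := Finset.mem_image.1 hγ
  exact ⟨h.zeta_ordinate j, h.ordinate_pos j, h.ordinate_lt_height j⟩

/-- The brackets exhibit `n` zeros on the line: `n ≤ N₀(T)`. [cite: EdwardsZeta1974, §8.3] -/
theorem le_criticalZeroCount (h : ZeroBracketing n T a b) (hT : 0 ≤ T) :
    n ≤ criticalZeroCount T := by
  classical
  have hc := criticalZeroCount_add_card_le le_rfl hT h.ordinates (fun γ hγ ↦
    let ⟨h1, h2, h3⟩ := h.ordinates_spec γ hγ; ⟨h1, h2, h3.le⟩)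
  rwa [criticalZeroCount_eq_zero_of_nonpos le_rfl, zero_add, h.card_ordinates] at hc

/-- `n ≤ N(T)`. [folklore] -/
theorem le_zetaZeroCount (h : ZeroBracketing n T a b) (hT : 0 ≤ T) : n ≤ zetaZeroCount T :=
  (h.le_criticalZeroCount hT).trans (criticalZeroCount_le T)

/-- **RH up to `T` and the exact counts** from a bracketing and an upper bound `N(T) ≤ n`
(the latter from Turing's method, `TuringMethod.lean`, or from a certified change of argument
along `[½, 2] × {T}`, `zetaZeroCount_eq_of_hpieces`). [cite: EdwardsZeta1974, §8.2] -/
theorem riemannHypothesisUpTo (h : ZeroBracketing n T a b) (hT : 0 ≤ T)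
    (hN : zetaZeroCount T ≤ n) :
    RiemannHypothesisUpTo T ∧ zetaZeroCount T = n ∧ criticalZeroCount T = n := by
  have h1 := h.le_criticalZeroCount hT
  have h2 := criticalZeroCount_le T
  exact ⟨RiemannHypothesisUpTo.of_zetaZeroCount_le_criticalZeroCount (by omega), by omega,
    by omega⟩

/-- `N(T) = |Z|`, the hypothesis of `zeros_below_of_count_eq_card`. [folklore] -/
theorem zetaZeroCount_eq_card (h : ZeroBracketing n T a b) (hT : 0 ≤ T)
    (hN : zetaZeroCount T ≤ n) : zetaZeroCount T = h.ordinates.card := by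
  rw [h.card_ordinates, (h.riemannHypothesisUpTo hT hN).2.1]

/-- **The zero clause of the kernel theorem below `T`** (via `zeros_below_of_count_eq_card`):
with `N(T) ≤ n`, every zero of `ζ` with `0 < Re ρ < 1` and `|Im ρ| < T` is on the critical line
and simple. [cite: Brent1979, §4] -/
theorem zero_clause (h : ZeroBracketing n T a b) (hT : 0 ≤ T) (hN : zetaZeroCount T ≤ n) :
    ∀ ρ : ℂ, riemannZeta ρ = 0 → 0 < ρ.re → ρ.re < 1 → |ρ.im| < T →
      ρ.re = 1 / 2 ∧ deriv riemannZeta ρ ≠ 0 :=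
  (zeros_below_of_count_eq_card h.ordinates h.ordinates_spec (h.zetaZeroCount_eq_card hT hN)).1

/-- **Completeness** (via `zeros_below_of_count_eq_card`): with `N(T) ≤ n`, the ordinate of every
zero with `0 < Im ρ < T` is one of the `γ_j`. [cite: Brent1979, §4] -/
theorem exists_eq_ordinate (h : ZeroBracketing n T a b) (hT : 0 ≤ T) (hN : zetaZeroCount T ≤ n)
    {ρ : ℂ} (hζ : riemannZeta ρ = 0) (h0 : 0 < ρ.re) (h1 : ρ.re < 1) (him : 0 < ρ.im)
    (hlt : ρ.im < T) : ∃ j, ρ.im = h.ordinate j := by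
  classical
  have hmem := (zeros_below_of_count_eq_card h.ordinates h.ordinates_spec
    (h.zetaZeroCount_eq_card hT hN)).2 ρ hζ h0 h1 him hlt
  obtain ⟨j, -, hj⟩ := Finset.mem_image.1 hmem
  exact ⟨j, hj.symm⟩

/-- In particular a zero `½ + iγ` with `0 < γ < T` has its ordinate in one of the brackets.
[folklore] -/
theorem mem_brackets_of_zero (h : ZeroBracketing n T a b) (hT : 0 ≤ T)
    (hN : zetaZeroCount T ≤ n) {γ : ℝ} (hζ : riemannZeta (1 / 2 + γ * I) = 0) (h0 : 0 < γ)
    (hγT : γ < T) : ∃ j, a j ≤ γ ∧ γ ≤ b j := by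
  obtain ⟨j, hj⟩ := h.exists_eq_ordinate hT hN hζ (by simp) (by norm_num) (by simpa using h0)
    (by simpa using hγT)
  simp only [add_im, one_div, inv_im, mul_im, ofReal_re, I_im, mul_one, ofReal_im, I_re,
    mul_zero, add_zero] at hj
  refine ⟨j, ?_, ?_⟩
  · have := h.le_ordinate j
    simp at hj
    linarith
  · have := h.ordinate_le j
    simp at hj
    linarith

end ZeroBracketing

/-! ## The summand of `h_K` and the sums over the brackets -/

/-- The summand of `h_K(y)` at a point `½ + iγ` of the critical line:
`F_y(γ) = k(γ) e^{iγy} / ((½+iγ) ζ'(½+iγ))` (so that `Re h_K(y) = Σ_j 2 Re F_y(γ_j)` over the located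
ordinates, `re_inghamSum_eq_sum_of_zeros`). [cite: OdlyzkoTeRiele1985, Theorem p. 144 (display after (2.18))] -/
def inghamTerm (k : ℝ → ℂ) (y γ : ℝ) : ℂ :=
  k γ * cexp (I * (γ * y)) / ((1 / 2 + γ * I) * deriv riemannZeta (1 / 2 + γ * I))

namespace ZeroBracketing

variable {n : ℕ} {T : ℝ} {a b : Fin n → ℝ}

/-- **`Re h_K(y)` over the brackets** (the Jurkat–Peyerimhoff weight is real and even): with
`N(T) ≤ n`, `Re h_K(y) = Σ_j 2 Re F_y(γ_j)`. [cite: OdlyzkoTeRiele1985, Theorem p. 144 and §4.3] -/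
theorem re_inghamSum_eq (h : ZeroBracketing n T a b) (hT : 0 ≤ T) (hN : zetaZeroCount T ≤ n)
    (y : ℝ) :
    (inghamSum (fun t : ℝ => (jurkatPeyerimhoffKernel (t / T) : ℂ)) T y).re =
      ∑ j : Fin n, 2 * (inghamTerm (fun t : ℝ => (jurkatPeyerimhoffKernel (t / T) : ℂ)) y
        (h.ordinate j)).re := by
  classical
  have hzc := zeros_below_of_count_eq_card h.ordinates h.ordinates_spec
    (h.zetaZeroCount_eq_card hT hN)
  have := re_inghamSum_eq_sum_of_zeros h.ordinates h.ordinates_spec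
    (fun ρ hζ h0 h1 hγ ↦ (hzc.1 ρ hζ h0 h1 hγ).1) hzc.2
    (fun t : ℝ => (jurkatPeyerimhoffKernel (t / T) : ℂ))
    (fun t ↦ by simp only [neg_div, jurkatPeyerimhoffKernel_neg])
    (fun t ↦ Complex.conj_ofReal _) y
  rw [this, ordinates, Finset.sum_image (fun i _ j _ e ↦ h.ordinate_injective e)]
  rfl

/-! ## The rh.S22 statements from interval bounds over the brackets -/

/-- **The numerical fact from bounds over the brackets.** A zero bracketing of height `T > 0`,
an upper bound `N(T) ≤ n`, and bounds `1.06 < Σ_j 2 Re F_{y₁}(γ_j)`, `Σ_j 2 Re F_{y₂}(γ_j) < −1.009`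
valid for all `γ_j ∈ [a_j, b_j]` give `OdlyzkoTeRiele1985_numerics`, its zero clause included.
[cite: OdlyzkoTeRiele1985, §4.2–4.3 pp. 151–155] -/
theorem numerics_of_bounds (h : ZeroBracketing n T a b) (hT : 0 < T) (hN : zetaZeroCount T ≤ n)
    {y₁ y₂ : ℝ}
    (h₁ : ∀ γ : Fin n → ℝ, (∀ j, a j ≤ γ j ∧ γ j ≤ b j) → (1.06 : ℝ) <
      ∑ j : Fin n, 2 * (inghamTerm (fun t : ℝ => (jurkatPeyerimhoffKernel (t / T) : ℂ)) y₁ (γ j)).re)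
    (h₂ : ∀ γ : Fin n → ℝ, (∀ j, a j ≤ γ j ∧ γ j ≤ b j) →
      ∑ j : Fin n, 2 * (inghamTerm (fun t : ℝ => (jurkatPeyerimhoffKernel (t / T) : ℂ)) y₂ (γ j)).re
        < -1.009) :
    OdlyzkoTeRiele1985_numerics := by
  have hγ : ∀ j, a j ≤ h.ordinate j ∧ h.ordinate j ≤ b j := fun j ↦ ⟨h.le_ordinate j, h.ordinate_le j⟩
  refine ⟨T, hT, h.zero_clause hT.le hN, ⟨y₁, ?_⟩, ⟨y₂, ?_⟩⟩
  · rw [h.re_inghamSum_eq hT.le hN]; exact h₁ _ hγ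
  · rw [h.re_inghamSum_eq hT.le hN]; exact h₂ _ hγ

/-- **Table 3 itself** from bounds over the brackets at a height `T ∈ (2515, 2516)` (as printed:
`T = γ₂₀₀₀ = 2515.286…`, `n = 2000`). [cite: OdlyzkoTeRiele1985, §4.3 Table 3 p. 155] -/
theorem table3_of_bounds (h : ZeroBracketing n T a b) (hT₁ : 2515 < T) (hT₂ : T < 2516)
    (hN : zetaZeroCount T ≤ n) {y₁ y₂ : ℝ}
    (h₁ : ∀ γ : Fin n → ℝ, (∀ j, a j ≤ γ j ∧ γ j ≤ b j) → (1.06 : ℝ) <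
      ∑ j : Fin n, 2 * (inghamTerm (fun t : ℝ => (jurkatPeyerimhoffKernel (t / T) : ℂ)) y₁ (γ j)).re)
    (h₂ : ∀ γ : Fin n → ℝ, (∀ j, a j ≤ γ j ∧ γ j ≤ b j) →
      ∑ j : Fin n, 2 * (inghamTerm (fun t : ℝ => (jurkatPeyerimhoffKernel (t / T) : ℂ)) y₂ (γ j)).re
        < -1.009) :
    OdlyzkoTeRiele1985_table3 := by
  have hγ : ∀ j, a j ≤ h.ordinate j ∧ h.ordinate j ≤ b j := fun j ↦ ⟨h.le_ordinate j, h.ordinate_le j⟩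
  refine ⟨T, hT₁, hT₂, ⟨y₁, ?_⟩, ⟨y₂, ?_⟩⟩
  · rw [h.re_inghamSum_eq (by linarith) hN]; exact h₁ _ hγ
  · rw [h.re_inghamSum_eq (by linarith) hN]; exact h₂ _ hγ

/-- **rh.S22, `limsup` side, from bounds over the brackets.** [cite: OdlyzkoTeRiele1985, §1 p. 139 and §4.3 p. 155] -/
theorem limsup_of_bounds (h : ZeroBracketing n T a b) (hT : 0 < T) (hN : zetaZeroCount T ≤ n)
    {y : ℝ}
    (h₁ : ∀ γ : Fin n → ℝ, (∀ j, a j ≤ γ j ∧ γ j ≤ b j) → (1.06 : ℝ) <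
      ∑ j : Fin n, 2 * (inghamTerm (fun t : ℝ => (jurkatPeyerimhoffKernel (t / T) : ℂ)) y (γ j)).re) :
    odlyzko_te_riele_limsup := by
  have hγ : ∀ j, a j ≤ h.ordinate j ∧ h.ordinate j ≤ b j := fun j ↦ ⟨h.le_ordinate j, h.ordinate_le j⟩
  have hk := (kernelTheorem_jurkatPeyerimhoff OdlyzkoTeRiele1985_kernelTheorem_holds
    jurkatPeyerimhoffKernel_admissible_holds hT (h.zero_clause hT.le hN) y).1
  set r : ℝ := (inghamSum (fun t : ℝ => (jurkatPeyerimhoffKernel (t / T) : ℂ)) T y).re with hr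
  have hr' : (1.06 : ℝ) < r := by rw [hr, h.re_inghamSum_eq hT.le hN]; exact h₁ _ hγ
  exact ⟨(1.06 + r) / 2, by linarith, hk _ (by linarith)⟩

/-- **rh.S22, `liminf` side, from bounds over the brackets.** [cite: OdlyzkoTeRiele1985, §1 p. 139 and §4.3 p. 155] -/
theorem liminf_of_bounds (h : ZeroBracketing n T a b) (hT : 0 < T) (hN : zetaZeroCount T ≤ n)
    {y : ℝ}
    (h₂ : ∀ γ : Fin n → ℝ, (∀ j, a j ≤ γ j ∧ γ j ≤ b j) →
      ∑ j : Fin n, 2 * (inghamTerm (fun t : ℝ => (jurkatPeyerimhoffKernel (t / T) : ℂ)) y (γ j)).re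
        < -1.009) :
    odlyzko_te_riele_liminf := by
  have hγ : ∀ j, a j ≤ h.ordinate j ∧ h.ordinate j ≤ b j := fun j ↦ ⟨h.le_ordinate j, h.ordinate_le j⟩
  have hk := (kernelTheorem_jurkatPeyerimhoff OdlyzkoTeRiele1985_kernelTheorem_holds
    jurkatPeyerimhoffKernel_admissible_holds hT (h.zero_clause hT.le hN) y).2
  set r : ℝ := (inghamSum (fun t : ℝ => (jurkatPeyerimhoffKernel (t / T) : ℂ)) T y).re with hr
  have hr' : r < -1.009 := by rw [hr, h.re_inghamSum_eq hT.le hN]; exact h₂ _ hγ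
  exact ⟨(-1.009 + r) / 2, by linarith, hk _ (by linarith)⟩

/-- **The Mertens conjecture is false, from bounds over the brackets**: the minimal version —
any height `T > 0`, any `y`, and a validated bound `Σ_j 2 Re F_y(γ_j) > 1` over the brackets.
[cite: OdlyzkoTeRiele1985, (1.3) p. 139, Theorem p. 144, p. 155] -/
theorem not_mertens_conjecture_of_bounds (h : ZeroBracketing n T a b) (hT : 0 < T)
    (hN : zetaZeroCount T ≤ n) {y : ℝ}
    (h₁ : ∀ γ : Fin n → ℝ, (∀ j, a j ≤ γ j ∧ γ j ≤ b j) → (1 : ℝ) <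
      ∑ j : Fin n, 2 * (inghamTerm (fun t : ℝ => (jurkatPeyerimhoffKernel (t / T) : ℂ)) y (γ j)).re) :
    not_mertens_conjecture := by
  have hγ : ∀ j, a j ≤ h.ordinate j ∧ h.ordinate j ≤ b j := fun j ↦ ⟨h.le_ordinate j, h.ordinate_le j⟩
  have hk := (kernelTheorem_jurkatPeyerimhoff OdlyzkoTeRiele1985_kernelTheorem_holds
    jurkatPeyerimhoffKernel_admissible_holds hT (h.zero_clause hT.le hN) y).1
  set r : ℝ := (inghamSum (fun t : ℝ => (jurkatPeyerimhoffKernel (t / T) : ℂ)) T y).re with hr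
  have hr' : (1 : ℝ) < r := by rw [hr, h.re_inghamSum_eq hT.le hN]; exact h₁ _ hγ
  have hfr := hk ((1 + r) / 2) (by linarith)
  refine not_mertens_conjecture_of_frequently ?_
  refine (hfr.and_eventually (eventually_ge_atTop 0)).mono fun x ⟨hx, hx0⟩ ↦ ?_
  have hs : 0 ≤ Real.sqrt x := Real.sqrt_nonneg x
  calc Real.sqrt x ≤ (1 + r) / 2 * Real.sqrt x := by nlinarith
    _ < mertensFunction x := hx
    _ ≤ |(mertensFunction x : ℝ)| := le_abs_self _

end ZeroBracketing

end Literature.NumberTheory.LFunctions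

end
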